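import Mathlib
import Summits.Ventures.PercRepro2.Defs
import Summits.Ventures.PercRepro2.Graph
import Summits.Ventures.PercRepro2.Harris
import Summits.Ventures.PercRepro2.Events
import Summits.Ventures.PercRepro2.Induced
import Summits.Ventures.PercRepro2.VdBKahn
import Summits.Ventures.PercRepro2.HullTree
import Summits.Ventures.PercRepro2.GateDefs
import Summits.Ventures.PercRepro2.GateFrame
import Summits.Ventures.PercRepro2.GateAnatomy
import Summits.Ventures.PercRepro2.GateCylinder
import Summits.Ventures.PercRepro2.GateForest
import Summits.Ventures.PercRepro2.GateSplit

/-!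
# The general gate with a single hull vertex, `(GATE A, {w})`, on every forest (blind cell PercRepro2,
mine-c g8; MINE-C.md §15, proofs/MINEC-LSMGATE.md §10)

For `B = {w}` the class `A₂ = {w ∈ C(t)} ∩ {s ↮ {t} ∪ A}` of `GateSplit` has the cylinder form on every
forest (`GateForest.conn_iff_cylinder`), so `covA₂ ≥ 0` by van den Berg–Kahn under the forced weights
(`GateCylinder.prob_inter_cylinder`, avoided set `{t} ∪ A`), and with the positivity-free class reduction
(`gateRow_of_covC_nonneg`, the `GateSplit` shift theorem) this gives **`gateRow_of_isForest`**:
`Gate.GateRow s {t} a b A {w}` for EVERY exit set `A` on every forest, unconditionally.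
-/

namespace Summit.Ventures.PercRepro2

namespace GateSplitForest

variable {V : Type*} {E : Type*} [Fintype E] [DecidableEq E] [Fintype V] [DecidableEq V]
  {R : Type*} [Field R] [LinearOrder R] [IsStrictOrderedRing R]

variable (p : E → R) (ends : E → Sym2 V) (s t a b : V) (A B : Finset V)

/-! ## The class-wise reduction without positivity hypotheses -/

/-- The cleared contribution of a class `C`: `E_C = r² P(XY; C) − r (x P(Y; C) + y P(X; C)) + x y P(C)`. -/
noncomputable def classExpr (C : Set (Config E)) : R :=
  prob p (avoidAll ends s {t}) ^ 2 * prob p (connAll ends s ({a} ∪ {b}) ∩ C) -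
    prob p (avoidAll ends s {t}) *
      (prob p (connAll ends s {a} ∩ avoidAll ends s {t}) * prob p (connAll ends s {b} ∩ C) +
        prob p (connAll ends s {b} ∩ avoidAll ends s {t}) * prob p (connAll ends s {a} ∩ C)) +
    prob p (connAll ends s {a} ∩ avoidAll ends s {t}) * prob p (connAll ends s {b} ∩ avoidAll ends s {t}) *
      prob p C

omit [Fintype V] [LinearOrder R] [IsStrictOrderedRing R] in
/-- The gate expression is the sum of the two class contributions. -/
lemma gateExpr_eq_add :
    GateSplit.gateExpr p ends s t a b A B =
      classExpr p ends s t a b (GateSplit.classA₁ ends s t B) +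
        classExpr p ends s t a b (GateSplit.classA₂ ends s t A B) := by
  unfold GateSplit.gateExpr classExpr
  rw [GateSplit.prob_inter_gate, GateSplit.prob_inter_gate, GateSplit.prob_inter_gate,
    GateSplit.prob_gate]
  ring

omit [Fintype V] [LinearOrder R] [IsStrictOrderedRing R] in
/-- `P(C) · E_C = r² covC + shiftC`. -/
lemma mul_classExpr (C : Set (Config E)) :
    prob p C * classExpr p ends s t a b C =
      prob p (avoidAll ends s {t}) ^ 2 * GateAnatomy.covC p ends s a b C +
        GateAnatomy.shiftC p ends s t a b C := by
  unfold classExpr GateAnatomy.covC GateAnatomy.shiftC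
  ring

omit [Fintype V] in
/-- A class of zero mass contributes zero. -/
lemma classExpr_eq_zero_of_prob_eq_zero (hp : IsProbVec p) (C : Set (Config E)) (hC : prob p C = 0) :
    classExpr p ends s t a b C = 0 := by
  have h1 : prob p (connAll ends s ({a} ∪ {b}) ∩ C) = 0 :=
    le_antisymm (hC ▸ prob_mono hp Set.inter_subset_right) (prob_nonneg hp _)
  have h2 : prob p (connAll ends s {a} ∩ C) = 0 :=
    le_antisymm (hC ▸ prob_mono hp Set.inter_subset_right) (prob_nonneg hp _)
  have h3 : prob p (connAll ends s {b} ∩ C) = 0 :=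
    le_antisymm (hC ▸ prob_mono hp Set.inter_subset_right) (prob_nonneg hp _)
  unfold classExpr
  rw [h1, h2, h3, hC]
  ring

omit [Fintype V] in
/-- A class with `covC ≥ 0` and a nonnegative shift product contributes `≥ 0`. -/
lemma classExpr_nonneg (hp : IsProbVec p) (C : Set (Config E))
    (hcov : 0 ≤ GateAnatomy.covC p ends s a b C) (hshift : 0 ≤ GateAnatomy.shiftC p ends s t a b C) :
    0 ≤ classExpr p ends s t a b C := by
  rcases (prob_nonneg hp C).lt_or_eq with hpos | hzero
  · have h := mul_classExpr p ends s t a b C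
    have hr : 0 ≤ prob p (avoidAll ends s {t}) ^ 2 := sq_nonneg _
    have : 0 ≤ prob p C * classExpr p ends s t a b C := by rw [h]; positivity
    exact (mul_nonneg_iff_of_pos_left hpos).1 this
  · rw [classExpr_eq_zero_of_prob_eq_zero p ends s t a b hp C hzero.symm]

/-- **The general gate from the two class covariances** (no positivity hypotheses):
`0 ≤ covA₁ → 0 ≤ covA₂ → Gate.GateRow s {t} a b A B`. -/
theorem gateRow_of_covC_nonneg (hp : IsProbVec p)
    (h₁ : 0 ≤ GateAnatomy.covC p ends s a b (GateSplit.classA₁ ends s t B))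
    (h₂ : 0 ≤ GateAnatomy.covC p ends s a b (GateSplit.classA₂ ends s t A B)) :
    Gate.GateRow p ends s {t} a b A B := by
  rw [GateSplit.gateRow_iff, gateExpr_eq_add]
  have s₁ : 0 ≤ GateAnatomy.shiftC p ends s t a b (GateSplit.classA₁ ends s t B) := by
    unfold GateAnatomy.shiftC
    have h1 := GateSplit.shiftA₁_nonneg p ends s t a B hp
    have h2 := GateSplit.shiftA₁_nonneg p ends s t b B hp
    exact mul_nonneg (by linarith) (by linarith)
  have s₂ : 0 ≤ GateAnatomy.shiftC p ends s t a b (GateSplit.classA₂ ends s t A B) := by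
    unfold GateAnatomy.shiftC
    have h1 := GateSplit.shiftA₂_nonpos p ends s t a A B hp
    have h2 := GateSplit.shiftA₂_nonpos p ends s t b A B hp
    exact mul_nonneg_of_nonpos_of_nonpos (by linarith) (by linarith)
  exact add_nonneg (classExpr_nonneg p ends s t a b hp _ h₁ s₁) (classExpr_nonneg p ends s t a b hp _ h₂ s₂)

/-- **The general gate under the FKG lattice condition**, positivity-free. -/
theorem gateRow_of_massA₂_logSupermod (hp : IsProbVec p)
    (h : GateSplit.MassA₂LogSupermod p ends s t A B) : Gate.GateRow p ends s {t} a b A B :=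
  gateRow_of_covC_nonneg p ends s t a b A B hp (GateSplit.covC_classA₁_nonneg p ends s t a b B hp)
    (GateSplit.covC_classA₂_nonneg p ends s t a b A B hp h)

/-! ## A single hull vertex: the cylinder case and forests -/

variable (w : V)

omit [Fintype E] [DecidableEq E] [Fintype V] [DecidableEq V] [Field R] [LinearOrder R]
  [IsStrictOrderedRing R] in
/-- For `B = {w}`, `hitsUW` is the cluster event `{w ∈ C(t)}`. -/
lemma hitsUW_singleton : GateSplit.hitsUW ends t {w} = clusterInEvent ends t {W : Set V | w ∈ W} := by
  ext ω
  simp [GateSplit.hitsUW, clusterInEvent]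

/-- **Class `A₂` with `B = {w}` is positively associated when `{w ∈ C(t)}` is a cylinder**:
van den Berg–Kahn under the forced weights with the avoided set `{t} ∪ A`. -/
theorem covC_classA₂_nonneg_of_cylinder (hp : IsProbVec p) (P : Finset E)
    (hB : GateSplit.classA₂ ends s t A {w} = GateCylinder.cylinder P ∩ avoidAll ends s ({t} ∪ A)) :
    0 ≤ GateAnatomy.covC p ends s a b (GateSplit.classA₂ ends s t A {w}) := by
  unfold GateAnatomy.covC
  rw [hB]
  have e0 : GateCylinder.cylinder P ∩ avoidAll ends s ({t} ∪ A) =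
      avoidAll ends s ({t} ∪ A) ∩ GateCylinder.cylinder P := Set.inter_comm _ _
  have e1 : ∀ X : Finset V, connAll ends s X ∩ (GateCylinder.cylinder P ∩ avoidAll ends s ({t} ∪ A)) =
      (connAll ends s X ∩ avoidAll ends s ({t} ∪ A)) ∩ GateCylinder.cylinder P := by
    intro X; ext ω; simp only [Set.mem_inter_iff]; tauto
  rw [e1 ({a} ∪ {b}), e1 {a}, e1 {b}, e0, GateCylinder.prob_inter_cylinder,
    GateCylinder.prob_inter_cylinder, GateCylinder.prob_inter_cylinder, GateCylinder.prob_inter_cylinder]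
  have hc : 0 ≤ ∏ e ∈ P, p e := Finset.prod_nonneg fun e _ => hp.nonneg e
  have key := vdBK (GateCylinder.forceOpen p P) (GateCylinder.isProbVec_forceOpen hp P) ends s {a} {b}
    ({t} ∪ A) ({t} ∪ A)
  rw [Finset.inter_self, Finset.union_self] at key
  have hc2 : 0 ≤ (∏ e ∈ P, p e) * (∏ e ∈ P, p e) := mul_nonneg hc hc
  nlinarith [mul_le_mul_of_nonneg_left key hc2]

omit [DecidableEq E] [Fintype V] in
/-- On a forest, class `A₂` with `B = {w}` is the cylinder of the `t–w` path intersected with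
`{s ↮ {t} ∪ A}`. -/
lemma classA₂_eq_cylinder {ends : E → Sym2 V} (hF : Hull.IsForest ends)
    (q : (openGraph ends (fun _ => true)).Path t w) :
    GateSplit.classA₂ ends s t A {w} =
      GateCylinder.cylinder (GateForest.edgeFinset ends q.1) ∩ avoidAll ends s ({t} ∪ A) := by
  unfold GateSplit.classA₂
  rw [hitsUW_singleton]
  congr 1
  ext ω
  simp only [clusterInEvent, cluster, Set.mem_setOf_eq]
  exact GateForest.conn_iff_cylinder hF q ω

omit [Fintype E] [DecidableEq E] [Fintype V] in
/-- If `t` and `w` are not joined in the graph of all edges, class `A₂` (with `B = {w}`) is empty. -/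
lemma classA₂_eq_empty_of_not_reachable {ends : E → Sym2 V}
    (h : ¬ (openGraph ends (fun _ => true)).Reachable t w) :
    GateSplit.classA₂ ends s t A {w} = ∅ := by
  ext ω
  simp only [GateSplit.classA₂, GateSplit.hitsUW, Set.mem_inter_iff, clusterInEvent, cluster,
    Set.mem_setOf_eq, Finset.mem_singleton, exists_eq_left, Set.mem_empty_iff_false, iff_false, not_and]
  intro hc
  exact absurd (hc.mono (openGraph_mono (Hull.le_allOpen ω))) h

/-- On a forest, class `A₂` with `B = {w}` is positively associated: `0 ≤ covA₂`. -/
theorem covC_classA₂_nonneg_of_isForest {ends : E → Sym2 V} (hF : Hull.IsForest ends)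
    (hp : IsProbVec p) : 0 ≤ GateAnatomy.covC p ends s a b (GateSplit.classA₂ ends s t A {w}) := by
  by_cases hr : (openGraph ends (fun _ => true)).Reachable t w
  · obtain ⟨wk⟩ := hr
    exact covC_classA₂_nonneg_of_cylinder p ends s t a b A w hp
      (GateForest.edgeFinset ends wk.toPath.1) (classA₂_eq_cylinder s t A w hF wk.toPath)
  · rw [classA₂_eq_empty_of_not_reachable s t A w hr]
    unfold GateAnatomy.covC
    simp [prob]

/-- **`(GATE A, {w})` holds on every forest** (unconditional): for a forest `ends`, admissible
weights, every root `s`, avoided vertex `t`, markers `a, b`, exit set `A` and hull vertex `w`,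
`Gate.GateRow s {t} a b A {w}`. -/
theorem gateRow_of_isForest {ends : E → Sym2 V} (hF : Hull.IsForest ends) (hp : IsProbVec p) :
    Gate.GateRow p ends s {t} a b A {w} :=
  gateRow_of_covC_nonneg p ends s t a b A {w} hp (GateSplit.covC_classA₁_nonneg p ends s t a b {w} hp)
    (covC_classA₂_nonneg_of_isForest p s t a b A w hF hp)

end GateSplitForest

end Summit.Ventures.PercRepro2
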